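import Mathlib.Analysis.Matrix.Order
import Mathlib.LinearAlgebra.Matrix.Rank
import HarnessLib

/-!
# Route `BalabanIR`, crux `BirComplexStableXYR` (item `stmt-HubbardSuperconductivity-14845`),
# line `fat-gaussian-defect-calculus`: stub Q1 `stub_coulombSquare`

Helper (`--supports`) for the crux
`Summit.HubbardSuperconductivity.HubbardSuperconductivity.Theses.BalabanIR.BirComplexStableXYR`,
line `fat-gaussian-defect-calculus` (chapter 1, the exact Fröhlich–Spencer unfolding of the torus integral),
stub Q1 `stub_coulombSquare` (Coulomb square completion).

**Statement.** Let `H : Matrix k k ℝ` be positive semidefinite (the window Hessian form on `1`-cochains,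
index `k` = edges), `D : Matrix k m ℝ` any matrix (the coboundary `d₀` from `0`-cochains, index `m` = sites)
and `a : k → ℝ` (the integer vortex gauge field).  Then the normal equations `Dᵀ H D ψ = Dᵀ H a` have a
solution `ψ`, and for every such solution the square completes exactly:
`⟨Dφ − a, H(Dφ − a)⟩ = ⟨D(φ − ψ), H D(φ − ψ)⟩ + ⟨a − Dψ, H(a − Dψ)⟩` for all `φ`
(`σ := a − Dψ` is the Coulomb strain of the vortex current, `⟨σ, Hσ⟩` the vortex-loop energy).

**Proof.** SOLVABILITY: `ker (Dᵀ H D) = ker (H D)` because `Dᵀ H D v = 0` gives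
`⟨Dv, H Dv⟩ = ⟨v, Dᵀ H D v⟩ = 0`, and a positive semidefinite form vanishes only on its kernel
(Mathlib `Matrix.PosSemidef.dotProduct_mulVec_zero_iff`).  By rank–nullity the ranges of `Dᵀ H D` and
`H D` have the same dimension, which is also the dimension of the range of `(H D)ᵀ = Dᵀ H`
(`Matrix.rank_transpose`, `H` symmetric); since `range (Dᵀ H D) ≤ range (Dᵀ H)` the two ranges coincide,
so `Dᵀ H a ∈ range (Dᵀ H D)`.  SQUARE: write `Dφ − a = D(φ − ψ) − σ` and expand; the cross term
`⟨D(φ − ψ), Hσ⟩ = ⟨φ − ψ, Dᵀ H a − Dᵀ H D ψ⟩ = 0` is the normal equation (and `⟨σ, H D(φ−ψ)⟩` equals it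
by symmetry of `H`). [folklore]

Everything used is Mathlib linear algebra; no definition and no named fact is introduced.
-/

set_option linter.dupNamespace false -- summit = problem name (single-conjunct summit), D-0017

namespace Summit.HubbardSuperconductivity.HubbardSuperconductivity.Theorems.FSUnfolding

open Matrix

section CoulombSquare

variable {m k : Type*} [Fintype m] [Fintype k]

/-- Moving a real matrix across the dot product: `⟨D v, w⟩ = ⟨v, Dᵀ w⟩`. [folklore] -/
theorem coulomb_mulVec_dotProduct (D : Matrix k m ℝ) (v : m → ℝ) (w : k → ℝ) :
    D *ᵥ v ⬝ᵥ w = v ⬝ᵥ Dᵀ *ᵥ w := by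
  rw [dotProduct_mulVec, vecMul_transpose]

omit [Fintype k] in
/-- A real positive semidefinite matrix is symmetric: `Hᵀ = H`. [folklore] -/
theorem coulomb_transpose_eq {H : Matrix k k ℝ} (hH : H.PosSemidef) : Hᵀ = H := by
  rw [← conjTranspose_eq_transpose_of_trivial]
  exact hH.1

/-- The form of a real positive semidefinite (hence symmetric) matrix is symmetric:
`⟨x, H y⟩ = ⟨y, H x⟩`. [folklore] -/
theorem coulomb_dotProduct_mulVec_comm {H : Matrix k k ℝ} (hH : H.PosSemidef) (x y : k → ℝ) :
    x ⬝ᵥ H *ᵥ y = y ⬝ᵥ H *ᵥ x := by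
  calc x ⬝ᵥ H *ᵥ y = x ⬝ᵥ Hᵀ *ᵥ y := by rw [coulomb_transpose_eq hH]
    _ = y ⬝ᵥ H *ᵥ x := dotProduct_transpose_mulVec H x y

/-- Kernel of the normal matrix: for `H ⪰ 0`, `Dᵀ H D v = 0 ↔ H D v = 0` (a positive semidefinite form
vanishes only on its kernel, applied to `⟨Dv, H Dv⟩ = ⟨v, Dᵀ H D v⟩ = 0`). [folklore] -/
theorem coulomb_normal_mulVec_eq_zero_iff {H : Matrix k k ℝ} (hH : H.PosSemidef) (D : Matrix k m ℝ)
    (v : m → ℝ) : Dᵀ *ᵥ (H *ᵥ (D *ᵥ v)) = 0 ↔ H *ᵥ (D *ᵥ v) = 0 := by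
  constructor
  · intro h
    have h1 : D *ᵥ v ⬝ᵥ H *ᵥ (D *ᵥ v) = 0 := by
      rw [coulomb_mulVec_dotProduct, h, dotProduct_zero]
    exact (hH.dotProduct_mulVec_zero_iff (D *ᵥ v)).1 (by rwa [star_trivial])
  · intro h
    rw [h, mulVec_zero]

/-- Range of the normal matrix: for `H ⪰ 0` the ranges of `Dᵀ H D` and `Dᵀ H` (as linear maps) coincide
(`≤` is trivial; the dimensions agree by rank–nullity, `ker (Dᵀ H D) = ker (H D)` and
`rank (H D) = rank (H D)ᵀ = rank (Dᵀ H)`). [folklore] -/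
theorem coulomb_range_normal_eq {H : Matrix k k ℝ} (hH : H.PosSemidef) (D : Matrix k m ℝ) :
    LinearMap.range (Dᵀ * H * D).mulVecLin = LinearMap.range (Dᵀ * H).mulVecLin := by
  apply Submodule.eq_of_le_of_finrank_eq
  · rw [Matrix.mulVecLin_mul (Dᵀ * H) D]
    exact LinearMap.range_comp_le_range _ _
  · have hker : LinearMap.ker (Dᵀ * H * D).mulVecLin = LinearMap.ker (H * D).mulVecLin := by
      ext v
      simp only [LinearMap.mem_ker, Matrix.mulVecLin_apply, ← Matrix.mulVec_mulVec]
      exact coulomb_normal_mulVec_eq_zero_iff hH D v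
    have h1 := LinearMap.finrank_range_add_finrank_ker (Dᵀ * H * D).mulVecLin
    have h2 := LinearMap.finrank_range_add_finrank_ker (H * D).mulVecLin
    rw [hker] at h1
    have h3 : Module.finrank ℝ (LinearMap.range (Dᵀ * H * D).mulVecLin) =
        Module.finrank ℝ (LinearMap.range (H * D).mulVecLin) := by
      omega
    have h4 : (H * D).rank = (Dᵀ * H).rank := by
      rw [← Matrix.rank_transpose (H * D), Matrix.transpose_mul, coulomb_transpose_eq hH]
    unfold Matrix.rank at h4
    exact h3.trans h4

/-- Solvability of the normal equations: for `H ⪰ 0` and every `a` there is `ψ` with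
`Dᵀ H D ψ = Dᵀ H a` (`Dᵀ H a` lies in `range (Dᵀ H) = range (Dᵀ H D)`). [folklore] -/
theorem coulomb_normal_solvable {H : Matrix k k ℝ} (hH : H.PosSemidef) (D : Matrix k m ℝ)
    (a : k → ℝ) : ∃ ψ : m → ℝ, Dᵀ *ᵥ (H *ᵥ (D *ᵥ ψ)) = Dᵀ *ᵥ (H *ᵥ a) := by
  have hmem : Dᵀ *ᵥ (H *ᵥ a) ∈ LinearMap.range (Dᵀ * H * D).mulVecLin := by
    rw [coulomb_range_normal_eq hH D]
    exact LinearMap.mem_range.2 ⟨a, by rw [Matrix.mulVecLin_apply, Matrix.mulVec_mulVec]⟩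
  obtain ⟨ψ, hψ⟩ := LinearMap.mem_range.1 hmem
  refine ⟨ψ, ?_⟩
  rw [Matrix.mulVecLin_apply, ← Matrix.mulVec_mulVec, ← Matrix.mulVec_mulVec] at hψ
  exact hψ

/-- Completing the square: if `ψ` solves the normal equations `Dᵀ H D ψ = Dᵀ H a` (with `H ⪰ 0`, used
only through the symmetry of `H`), then for every `φ`
`⟨Dφ − a, H(Dφ − a)⟩ = ⟨D(φ − ψ), H D(φ − ψ)⟩ + ⟨a − Dψ, H(a − Dψ)⟩`: with `σ := a − Dψ` one has
`Dφ − a = D(φ − ψ) − σ`, and the cross term `⟨D(φ − ψ), Hσ⟩ = ⟨φ − ψ, Dᵀ H a − Dᵀ H D ψ⟩ = 0`. [folklore] -/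
theorem coulomb_complete_square {H : Matrix k k ℝ} (hH : H.PosSemidef) (D : Matrix k m ℝ) (a : k → ℝ)
    (ψ : m → ℝ) (hψ : Dᵀ *ᵥ (H *ᵥ (D *ᵥ ψ)) = Dᵀ *ᵥ (H *ᵥ a)) (φ : m → ℝ) :
    (D *ᵥ φ - a) ⬝ᵥ H *ᵥ (D *ᵥ φ - a) =
      D *ᵥ (φ - ψ) ⬝ᵥ H *ᵥ (D *ᵥ (φ - ψ)) + (a - D *ᵥ ψ) ⬝ᵥ H *ᵥ (a - D *ᵥ ψ) := by
  have hdecomp : D *ᵥ φ - a = D *ᵥ (φ - ψ) - (a - D *ᵥ ψ) := by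
    rw [mulVec_sub]
    abel
  have hσ : Dᵀ *ᵥ (H *ᵥ (a - D *ᵥ ψ)) = 0 := by
    rw [mulVec_sub, mulVec_sub, ← hψ, sub_self]
  have hcross : D *ᵥ (φ - ψ) ⬝ᵥ H *ᵥ (a - D *ᵥ ψ) = 0 := by
    rw [coulomb_mulVec_dotProduct, hσ, dotProduct_zero]
  have hcross' : (a - D *ᵥ ψ) ⬝ᵥ H *ᵥ (D *ᵥ (φ - ψ)) = 0 := by
    rw [coulomb_dotProduct_mulVec_comm hH, hcross]
  rw [hdecomp]
  set u := D *ᵥ (φ - ψ) with hu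
  set σ := a - D *ᵥ ψ with hσdef
  rw [mulVec_sub, sub_dotProduct, dotProduct_sub, dotProduct_sub, hcross, hcross']
  ring

/-- **stub Q1 (M): Coulomb square completion.**  For a positive semidefinite form `H` on `1`-cochains
(index `k`) and a linear map `D` from `0`-cochains (index `m`) — here `D = d₀` and `H` the window Hessian
form — the normal equations `Dᵀ H D ψ = Dᵀ H a` are solvable for every `a` (`Dᵀ H a ⊥ ker (Dᵀ H D)`
because `vᵀDᵀHDv = 0 ⇒ HDv = 0`), and for any solution `ψ` the square completes exactly:
`⟨Dφ − a, H(Dφ − a)⟩ = ⟨D(φ−ψ), HD(φ−ψ)⟩ + ⟨a − Dψ, H(a − Dψ)⟩` (the cross term is the normal equation).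
`σ := a − Dψ` is the Coulomb strain, `⟨σ,Hσ⟩` the vortex-loop energy.  (The `DecidableEq` instances are
part of the registered signature and are not used.) [folklore] -/
theorem stub_coulombSquare :
    ∀ (m k : Type) [Fintype m] [Fintype k] [DecidableEq m] [DecidableEq k]
      (H : Matrix k k ℝ) (D : Matrix k m ℝ) (a : k → ℝ), H.PosSemidef →
      ∃ ψ : m → ℝ, D.transpose.mulVec (H.mulVec (D.mulVec ψ)) = D.transpose.mulVec (H.mulVec a) ∧
        ∀ φ : m → ℝ, (D.mulVec φ - a) ⬝ᵥ H.mulVec (D.mulVec φ - a) =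
          (D.mulVec (φ - ψ)) ⬝ᵥ H.mulVec (D.mulVec (φ - ψ)) + (a - D.mulVec ψ) ⬝ᵥ H.mulVec (a - D.mulVec ψ) := by
  intro m k _ _ _ _ H D a hH
  obtain ⟨ψ, hψ⟩ := coulomb_normal_solvable hH D a
  exact ⟨ψ, hψ, fun φ => coulomb_complete_square hH D a ψ hψ φ⟩

end CoulombSquare

end Summit.HubbardSuperconductivity.HubbardSuperconductivity.Theorems.FSUnfolding
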